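import Summits.AnomalousDissipation.AnomalousDissipation.Theorems.SawtoothPulseCascadeK1LocalisedCascadeCornerTraceGeomTerm
import Summits.AnomalousDissipation.AnomalousDissipation.Theorems.SawtoothPulseCascadeK1LocalisedCascadeCornerTraceSum
import Literature.Analysis.Calculus.HardyExteriorDecay

/-!
# K1loc — helper: THE ALL-ORDERS CORNER-TRACE BOUND, SUMMED OVER THE WINDOW («CT-GEO» 2/4)

Helper file of the prover lane on the crux `K1LocalisedCascade` (stmt-AnomalousDissipation-19491), route
`SawtoothPulseCascade` (S-D fibre ledger, corner-trace track; finding F-p1g9-1, memo v15).  The window sum of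
`…CornerTraceGeomTerm.cornerTraceGeom_term_le`: Cauchy–Schwarz ACROSS THE ORDERS with geometric weights `Λ^i`, then — order by
order — the residue-class bookkeeping and the finite Parseval identity of `…CornerTraceSum` applied to the coefficients `c_l l^i`:
  **`cornerTraceGeom_sum_sq_le`** —
  `Σ_{k∈W} |Σ_l c_l ĝ₀(k−l)|² ≤ (1+ε)(N/2π²)·Σ_{i<p} (τ_i/Λ^{2i})·(Tr_i⁻ + Tr_i⁺) + (1+ε⁻¹)(N²/π²)·σ_ξ·M_p·Σ_l|c_l|²`,
where `Tr_i^∓ = Σ_{r<N} |T_i((4r∓1)/(4N))|²`, `T_i(y) = Σ_l c_l l^i e^{2πily}` (the corner traces of `T^{(i)}/(2πi)^i`), and the three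
scalar hypotheses are bounds, uniform over the residue classes `k ≡ ρ (N)` of the window, for
`Σ_k Φ_Λ(k)Φ_i(k)Λ^i ≤ τ_i` (`Φ_i(k) = 1/(λ+k)^{i+1} + 1/(λ−k)^{i+1}`, `Φ_Λ = Σ_{i<p} Λ^iΦ_i`), `Σ_k ξ_p(k)² ≤ σ_ξ`
(`ξ_p = (1/(λ+k)^p + 1/(λ−k)^p)/D`) and `Σ_{l≡k}|l|^{2p} ≤ M_p`.  Closed forms for `τ_i, σ_ξ, M_p` are `…CornerTraceGeomSums`;
with the sup-line-energy inputs `Tr_i ≲ Λ^{2i}·Tr_0` of a block of fibres the main term collapses to `(1+ε)(N²Θ/π²)·Σ_iτ_i`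
(`…TraceKernelsDeriv`).  The splitting `(x+y)² ≤ (1+ε)x² + (1+ε⁻¹)y²` is `Literature.Analysis.Calculus.add_sq_le_eps`.
No definitions; nothing about the crux. [cite: Grafakos2014, Prop. 3.1.2 (5), §3.1.3] [problem: turb]
-/

-- `Summit.<Summit>.<Problem>`: single-conjunct summit, the duplicate namespace segment is deliberate.
set_option linter.dupNamespace false

noncomputable section

namespace Summit.AnomalousDissipation.AnomalousDissipation.Theorems.SawtoothPulseCascade.K1Window

open MeasureTheory Set Filter Topology Function Complex AddCircle
open scoped Real
open Literature.Analysis Literature.Analysis.FunctionSpaces Literature.Analysis.FunctionSpaces.Torus Literature.Analysis.FluidPDE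
open Literature.Analysis.FluidPDE.SawtoothCascade
open Summit.AnomalousDissipation.AnomalousDissipation.Theorems.SawtoothPulseCascade.K1Start

/-! ## §1 Cauchy–Schwarz across the orders -/

/-- **Cauchy–Schwarz across the orders with geometric weights**: for `Φ_i ≥ 0`, `z_i` real, `Λ > 0`,
`(Σ_{i<p} Φ_i z_i)² ≤ (Σ_{i<p} Φ_iΛ^i)·(Σ_{i<p} (Φ_i/Λ^i) z_i²)`. [folklore] -/
theorem sq_sum_le_geomWeights (p : ℕ) (Φ z : ℕ → ℝ) (hΦ : ∀ i, 0 ≤ Φ i) {Λ : ℝ} (hΛ : 0 < Λ) :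
    (∑ i ∈ Finset.range p, Φ i * z i) ^ 2 ≤
      (∑ i ∈ Finset.range p, Φ i * Λ ^ i) * ∑ i ∈ Finset.range p, Φ i / Λ ^ i * z i ^ 2 := by
  have h := Finset.sum_mul_sq_le_sq_mul_sq (Finset.range p) (fun i => Real.sqrt (Φ i * Λ ^ i))
    (fun i => Real.sqrt (Φ i / Λ ^ i) * z i)
  have hΛi : ∀ i, 0 < Λ ^ i := fun i => pow_pos hΛ i
  have e1 : ∀ i ∈ Finset.range p, Real.sqrt (Φ i * Λ ^ i) * (Real.sqrt (Φ i / Λ ^ i) * z i) = Φ i * z i := by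
    intro i _
    rw [← mul_assoc, ← Real.sqrt_mul (mul_nonneg (hΦ i) (hΛi i).le),
      show Φ i * Λ ^ i * (Φ i / Λ ^ i) = Φ i ^ 2 by field_simp, Real.sqrt_sq (hΦ i)]
  have e2 : ∀ i ∈ Finset.range p, Real.sqrt (Φ i * Λ ^ i) ^ 2 = Φ i * Λ ^ i := fun i _ =>
    Real.sq_sqrt (mul_nonneg (hΦ i) (hΛi i).le)
  have e3 : ∀ i ∈ Finset.range p, (Real.sqrt (Φ i / Λ ^ i) * z i) ^ 2 = Φ i / Λ ^ i * z i ^ 2 := fun i _ => by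
    rw [mul_pow, Real.sq_sqrt (div_nonneg (hΦ i) (hΛi i).le)]
  rw [Finset.sum_congr rfl e1, Finset.sum_congr rfl e2, Finset.sum_congr rfl e3] at h
  exact h

/-! ## §2 The window sum -/

set_option maxHeartbeats 800000 in
/-- **THE ALL-ORDERS CORNER-TRACE BOUND** (see the file header).  `N ≥ 1`, lobe `λ = L₂`, `g₀` the exact `N`-tooth chirp with lobe
`λ`, coefficients `c` on a finite `S` with `|l| ≤ L`, window `W` with `|k| + L + D ≤ L₂` (`D ≥ 1`), order `p`, weight base `Λ > 0`,
`ε > 0`, and scalars `τ_i, σ_ξ, M_p` bounding, for every residue class `ρ`, `Σ_{k∈W, k≡ρ} Φ_Λ(k)Φ_i(k)Λ^i`, `Σ_{k∈W, k≡ρ} ξ_p(k)²`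
and `Σ_{l∈S, l≡ρ} |l|^{2p}`.  Then
`Σ_{k∈W} |Σ_l c_l ĝ₀(k−l)|² ≤ (1+ε)(N/(2π²)) Σ_{i<p} (τ_i/Λ^{2i})(Tr_i⁻ + Tr_i⁺) + (1+ε⁻¹)(N²/π²) σ_ξ M_p Σ_l|c_l|²`.
[cite: Grafakos2014, Prop. 3.1.2 (5), §3.1.3] -/
theorem cornerTraceGeom_sum_sq_le {N : ℕ} (hN : 0 < N) {L₂ : ℕ} {g₀ : UnitAddCircle → ℂ}
    (hg₀ : ∀ t : ℝ, g₀ (t : UnitAddCircle) =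
      Complex.exp (-(2 * π * I * ((L₂ : ℤ) : ℂ) * ((tri (2 * π * N * t) / (2 * π * N) : ℝ) : ℂ))))
    (c : ℤ → ℂ) (S : Finset ℤ) {L D : ℕ} (hD : 0 < D) (hS : ∀ l ∈ S, |l| ≤ L)
    (W : Finset ℤ) (hW : ∀ k ∈ W, |k| + L + D ≤ (L₂ : ℤ)) (p : ℕ) {Λ ε : ℝ} (hΛ : 0 < Λ) (hε : 0 < ε)
    {τ : ℕ → ℝ} {σξ Mp : ℝ}
    (hτ : ∀ i ∈ Finset.range p, ∀ ρ : ℤ,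
      ∑ k ∈ W.filter (fun k => (N : ℤ) ∣ k - ρ),
        (∑ i' ∈ Finset.range p, Λ ^ i' * (1 / ((L₂ : ℝ) + k) ^ (i' + 1) + 1 / ((L₂ : ℝ) - k) ^ (i' + 1))) *
          (1 / ((L₂ : ℝ) + k) ^ (i + 1) + 1 / ((L₂ : ℝ) - k) ^ (i + 1)) * Λ ^ i ≤ τ i)
    (hσ : ∀ ρ : ℤ, ∑ k ∈ W.filter (fun k => (N : ℤ) ∣ k - ρ),
      ((1 / ((L₂ : ℝ) + k) ^ p + 1 / ((L₂ : ℝ) - k) ^ p) / D) ^ 2 ≤ σξ)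
    (hMp : ∀ k : ℤ, ∑ l ∈ S.filter (fun l => (N : ℤ) ∣ k - l), |(l : ℝ)| ^ (2 * p) ≤ Mp) :
    ∑ k ∈ W, ‖∑ l ∈ S, c l * fourierCoeff g₀ (k - l)‖ ^ 2 ≤
      (1 + ε) * ((N : ℝ) / (2 * π ^ 2)) * ∑ i ∈ Finset.range p, τ i / Λ ^ (2 * i) *
          (∑ r ∈ Finset.range N, ‖∑ l ∈ S, c l * (l : ℂ) ^ i * Complex.exp (2 * π * I * l * ((4 * (r : ℝ) - 1) / (4 * N)))‖ ^ 2 +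
            ∑ r ∈ Finset.range N, ‖∑ l ∈ S, c l * (l : ℂ) ^ i * Complex.exp (2 * π * I * l * ((4 * (r : ℝ) + 1) / (4 * N)))‖ ^ 2) +
        (1 + ε⁻¹) * ((N : ℝ) ^ 2 / π ^ 2) * σξ * Mp * ∑ l ∈ S, ‖c l‖ ^ 2 := by
  classical
  have hπ : 0 < π := Real.pi_pos
  have hNr : (0 : ℝ) < N := by exact_mod_cast hN
  have hNz : (0 : ℤ) < N := by exact_mod_cast hN
  have hDr : (0 : ℝ) < D := by exact_mod_cast hD
  have hkpos : ∀ k ∈ W, 0 < (L₂ : ℝ) + k ∧ 0 < (L₂ : ℝ) - k := by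
    intro k hk
    have h1 := hW k hk
    have h1' : |((k : ℤ) : ℝ)| + L + D ≤ L₂ := by have h := h1; exact_mod_cast h
    have := le_abs_self ((k : ℤ) : ℝ); have := neg_abs_le ((k : ℤ) : ℝ)
    have : (0 : ℝ) ≤ L := Nat.cast_nonneg _
    constructor <;> linarith
  set ω : ℤ → ℂ := fun x => Complex.exp (π * I * x / (2 * N)) with hω
  set ω' : ℤ → ℂ := fun x => Complex.exp (-(π * I * x / (2 * N))) with hω'
  set Sk : ℤ → Finset ℤ := fun k => S.filter fun l => (N : ℤ) ∣ k - l with hSk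
  -- the kernels
  set Φa : ℕ → ℤ → ℝ := fun i k => 1 / ((L₂ : ℝ) + k) ^ (i + 1) + 1 / ((L₂ : ℝ) - k) ^ (i + 1) with hΦa
  set ΦΛ : ℤ → ℝ := fun k => ∑ i ∈ Finset.range p, Λ ^ i * Φa i k with hΦΛ
  set ξ : ℤ → ℝ := fun k => (1 / ((L₂ : ℝ) + k) ^ p + 1 / ((L₂ : ℝ) - k) ^ p) / D with hξ
  have hΦa0 : ∀ k ∈ W, ∀ i, 0 ≤ Φa i k := by
    intro k hk i; obtain ⟨h1, h2⟩ := hkpos k hk; simp only [hΦa]; positivity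
  have hΦΛ0 : ∀ k ∈ W, 0 ≤ ΦΛ k := fun k hk =>
    Finset.sum_nonneg fun i _ => mul_nonneg (pow_nonneg hΛ.le _) (hΦa0 k hk i)
  have hξ0 : ∀ k ∈ W, 0 ≤ ξ k := by
    intro k hk; obtain ⟨h1, h2⟩ := hkpos k hk; simp only [hξ]; positivity
  -- the residue-class sums of order `i`
  set A : ℕ → ℤ → ℂ := fun i k => ∑ l ∈ Sk k, c l * (l : ℂ) ^ i * ω' l with hA
  set A' : ℕ → ℤ → ℂ := fun i k => ∑ l ∈ Sk k, c l * (l : ℂ) ^ i * ω l with hA'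
  set e : ℤ → ℝ := fun k => ∑ l ∈ Sk k, ‖c l‖ ^ 2 with he
  have he0 : ∀ k, 0 ≤ e k := fun k => Finset.sum_nonneg fun _ _ => sq_nonneg _
  -- Step 1: the per-`k` amplitude bound
  have hamp := cornerTraceGeom_term_le hN hg₀ c S hD hS W hW p
  -- Step 2: the per-`k` energy bound
  have hσ0 : 0 ≤ σξ := le_trans (Finset.sum_nonneg fun _ _ => sq_nonneg _) (hσ 0)
  have hMp0 : 0 ≤ Mp := le_trans (Finset.sum_nonneg fun _ _ => by positivity) (hMp 0)
  have hsq : ∀ k ∈ W, ‖∑ l ∈ S, c l * fourierCoeff g₀ (k - l)‖ ^ 2 ≤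
      ((N : ℝ) / (2 * π)) ^ 2 * ((1 + ε) * (2 * ΦΛ k * ∑ i ∈ Finset.range p, Φa i k / Λ ^ i * (‖A i k‖ ^ 2 + ‖A' i k‖ ^ 2)) +
        (1 + ε⁻¹) * (4 * ξ k ^ 2 * Mp * e k)) := by
    intro k hk
    have h1 := hamp k hk
    set x : ℝ := ∑ i ∈ Finset.range p, Φa i k * (‖A i k‖ + ‖A' i k‖) with hx
    set y : ℝ := 2 * ξ k * ∑ l ∈ Sk k, ‖c l‖ * |(l : ℝ)| ^ p with hy
    have hx0 : 0 ≤ x := Finset.sum_nonneg fun i _ => mul_nonneg (hΦa0 k hk i) (by positivity)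
    have hy0 : 0 ≤ y := mul_nonneg (mul_nonneg (by norm_num) (hξ0 k hk)) (Finset.sum_nonneg fun _ _ => by positivity)
    have h1' : ‖∑ l ∈ S, c l * fourierCoeff g₀ (k - l)‖ ≤ (N : ℝ) / (2 * π) * (x + y) := by
      simpa only [hx, hy, hΦa, hξ, hA, hA', hSk, hω, hω'] using h1
    -- Cauchy–Schwarz across the orders
    have hx2 : x ^ 2 ≤ 2 * ΦΛ k * ∑ i ∈ Finset.range p, Φa i k / Λ ^ i * (‖A i k‖ ^ 2 + ‖A' i k‖ ^ 2) := by
      have hcs := sq_sum_le_geomWeights p (fun i => Φa i k) (fun i => ‖A i k‖ + ‖A' i k‖) (hΦa0 k hk) hΛ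
      have hw : ∑ i ∈ Finset.range p, Φa i k * Λ ^ i = ΦΛ k := by
        simp only [hΦΛ]; exact Finset.sum_congr rfl fun i _ => mul_comm _ _
      rw [hw] at hcs
      refine hcs.trans ?_
      rw [mul_comm (2 : ℝ), mul_assoc]
      refine mul_le_mul_of_nonneg_left ?_ (hΦΛ0 k hk)
      rw [Finset.mul_sum]
      refine Finset.sum_le_sum fun i _ => ?_
      have h2 : (‖A i k‖ + ‖A' i k‖) ^ 2 ≤ 2 * (‖A i k‖ ^ 2 + ‖A' i k‖ ^ 2) := by
        nlinarith [sq_nonneg (‖A i k‖ - ‖A' i k‖)]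
      have h0 : 0 ≤ Φa i k / Λ ^ i := div_nonneg (hΦa0 k hk i) (pow_nonneg hΛ.le _)
      calc Φa i k / Λ ^ i * (‖A i k‖ + ‖A' i k‖) ^ 2 ≤ Φa i k / Λ ^ i * (2 * (‖A i k‖ ^ 2 + ‖A' i k‖ ^ 2)) :=
            mul_le_mul_of_nonneg_left h2 h0
        _ = 2 * (Φa i k / Λ ^ i * (‖A i k‖ ^ 2 + ‖A' i k‖ ^ 2)) := by ring
    -- Cauchy–Schwarz on the remainder
    have hy2 : y ^ 2 ≤ 4 * ξ k ^ 2 * Mp * e k := by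
      have hcs := Finset.sum_mul_sq_le_sq_mul_sq (Sk k) (fun l => |(l : ℝ)| ^ p) (fun l => ‖c l‖)
      have e1 : ∑ l ∈ Sk k, |(l : ℝ)| ^ p * ‖c l‖ = ∑ l ∈ Sk k, ‖c l‖ * |(l : ℝ)| ^ p :=
        Finset.sum_congr rfl fun l _ => mul_comm _ _
      have e2 : ∑ l ∈ Sk k, (|(l : ℝ)| ^ p) ^ 2 = ∑ l ∈ Sk k, |(l : ℝ)| ^ (2 * p) :=
        Finset.sum_congr rfl fun l _ => by rw [← pow_mul, mul_comm]
      rw [e1, e2] at hcs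
      have h3 : (∑ l ∈ Sk k, ‖c l‖ * |(l : ℝ)| ^ p) ^ 2 ≤ Mp * e k :=
        hcs.trans (mul_le_mul_of_nonneg_right (hMp k) (he0 k))
      calc y ^ 2 = 4 * ξ k ^ 2 * (∑ l ∈ Sk k, ‖c l‖ * |(l : ℝ)| ^ p) ^ 2 := by rw [hy]; ring
        _ ≤ 4 * ξ k ^ 2 * (Mp * e k) := mul_le_mul_of_nonneg_left h3 (by positivity)
        _ = 4 * ξ k ^ 2 * Mp * e k := by ring
    calc ‖∑ l ∈ S, c l * fourierCoeff g₀ (k - l)‖ ^ 2 ≤ ((N : ℝ) / (2 * π) * (x + y)) ^ 2 :=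
          pow_le_pow_left₀ (norm_nonneg _) h1' 2
      _ = ((N : ℝ) / (2 * π)) ^ 2 * (x + y) ^ 2 := by ring
      _ ≤ ((N : ℝ) / (2 * π)) ^ 2 * ((1 + ε) * x ^ 2 + (1 + ε⁻¹) * y ^ 2) :=
          mul_le_mul_of_nonneg_left (Literature.Analysis.Calculus.add_sq_le_eps x y hε) (sq_nonneg _)
      _ ≤ ((N : ℝ) / (2 * π)) ^ 2 * ((1 + ε) * (2 * ΦΛ k * ∑ i ∈ Finset.range p, Φa i k / Λ ^ i *
            (‖A i k‖ ^ 2 + ‖A' i k‖ ^ 2)) + (1 + ε⁻¹) * (4 * ξ k ^ 2 * Mp * e k)) := by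
          refine mul_le_mul_of_nonneg_left (add_le_add ?_ ?_) (sq_nonneg _)
          · exact mul_le_mul_of_nonneg_left hx2 (by linarith)
          · exact mul_le_mul_of_nonneg_left hy2 (by positivity)
  -- Step 3: grouping by `k mod N`
  set t : Finset ℤ := (Finset.range N).image (fun n : ℕ => (n : ℤ)) with ht
  have hmod_mem : ∀ k : ℤ, k % (N : ℤ) ∈ t := by
    intro k
    refine Finset.mem_image.mpr ⟨(k % (N : ℤ)).toNat, Finset.mem_range.mpr ?_, ?_⟩
    · have h1 := Int.emod_nonneg k hNz.ne'
      have h2 := Int.emod_lt_of_pos k hNz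
      omega
    · exact Int.toNat_of_nonneg (Int.emod_nonneg k hNz.ne')
  have hSk_mod : ∀ k ρ : ℤ, k % (N : ℤ) = ρ % (N : ℤ) → Sk k = Sk ρ := by
    intro k ρ hkρ
    simp only [hSk]
    refine Finset.filter_congr fun l _ => ?_
    rw [← Int.modEq_iff_dvd, ← Int.modEq_iff_dvd]
    show l % (N : ℤ) = k % (N : ℤ) ↔ l % (N : ℤ) = ρ % (N : ℤ)
    rw [hkρ]
  have hA_mod : ∀ i (k : ℤ), A i k = A i (k % (N : ℤ)) ∧ A' i k = A' i (k % (N : ℤ)) ∧ e k = e (k % (N : ℤ)) := by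
    intro i k
    have h := hSk_mod k (k % (N : ℤ)) (Int.emod_emod_of_dvd k (dvd_refl _)).symm
    refine ⟨?_, ?_, ?_⟩ <;> simp only [hA, hA', he, h]
  -- the fibre of `ρ ∈ t` in `W` is the residue class `N ∣ k − ρ`
  have hfib : ∀ ρ ∈ t, W.filter (fun k => k % (N : ℤ) = ρ) = W.filter (fun k => (N : ℤ) ∣ k - ρ) := by
    intro ρ hρ
    obtain ⟨n, hn, rfl⟩ := Finset.mem_image.mp hρ
    refine Finset.filter_congr fun k _ => ?_
    rw [← Int.modEq_iff_dvd]
    show k % (N : ℤ) = (n : ℤ) ↔ (n : ℤ) % (N : ℤ) = k % (N : ℤ)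
    rw [Int.emod_eq_of_lt (a := (n : ℤ)) (b := (N : ℤ)) (Int.natCast_nonneg n)
      (by exact_mod_cast Finset.mem_range.mp hn)]
    exact ⟨fun h => h.symm, fun h => h.symm⟩
  -- main term: Σ_k ΦΛ(k)Φa_i(k)Λ^{-i}·G_i(k mod N) ≤ τ_i Λ^{-2i} Σ_ρ G_i(ρ)
  have hmain_i : ∀ i ∈ Finset.range p,
      ∑ k ∈ W, ΦΛ k * (Φa i k / Λ ^ i * (‖A i k‖ ^ 2 + ‖A' i k‖ ^ 2)) ≤
        τ i / Λ ^ (2 * i) * ∑ ρ ∈ t, (‖A i ρ‖ ^ 2 + ‖A' i ρ‖ ^ 2) := by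
    intro i hi
    have hΛi : 0 < Λ ^ i := pow_pos hΛ i
    rw [← Finset.sum_fiberwise_of_maps_to (fun k _ => hmod_mem k), Finset.mul_sum]
    refine Finset.sum_le_sum fun ρ hρ => ?_
    have hρρ : ρ % (N : ℤ) = ρ := by
      obtain ⟨n, hn, rfl⟩ := Finset.mem_image.mp hρ
      exact Int.emod_eq_of_lt (Int.natCast_nonneg n) (by exact_mod_cast Finset.mem_range.mp hn)
    calc ∑ k ∈ W.filter (fun k => k % (N : ℤ) = ρ), ΦΛ k * (Φa i k / Λ ^ i * (‖A i k‖ ^ 2 + ‖A' i k‖ ^ 2))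
        = (∑ k ∈ W.filter (fun k => k % (N : ℤ) = ρ), ΦΛ k * Φa i k * Λ ^ i) *
            ((‖A i ρ‖ ^ 2 + ‖A' i ρ‖ ^ 2) / Λ ^ (2 * i)) := by
          rw [Finset.sum_mul]
          refine Finset.sum_congr rfl fun k hk => ?_
          have hkρ : k % (N : ℤ) = ρ := (Finset.mem_filter.mp hk).2
          obtain ⟨h1, h2, -⟩ := hA_mod i k
          rw [h1, h2, hkρ]
          have e2 : Λ ^ (2 * i) = Λ ^ i * Λ ^ i := by rw [two_mul, pow_add]
          rw [e2]
          field_simp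
      _ ≤ τ i * ((‖A i ρ‖ ^ 2 + ‖A' i ρ‖ ^ 2) / Λ ^ (2 * i)) := by
          refine mul_le_mul_of_nonneg_right ?_ (by positivity)
          rw [hfib ρ hρ]
          have := hτ i hi ρ
          simpa only [hΦΛ, hΦa] using this
      _ = τ i / Λ ^ (2 * i) * (‖A i ρ‖ ^ 2 + ‖A' i ρ‖ ^ 2) := by ring
  -- remainder term: Σ_k ξ(k)² e(k mod N) ≤ σξ Σ_ρ e ρ
  have hrem : ∑ k ∈ W, ξ k ^ 2 * Mp * e k ≤ σξ * Mp * ∑ ρ ∈ t, e ρ := by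
    rw [← Finset.sum_fiberwise_of_maps_to (fun k _ => hmod_mem k), Finset.mul_sum]
    refine Finset.sum_le_sum fun ρ hρ => ?_
    calc ∑ k ∈ W.filter (fun k => k % (N : ℤ) = ρ), ξ k ^ 2 * Mp * e k
        = (∑ k ∈ W.filter (fun k => k % (N : ℤ) = ρ), ξ k ^ 2) * (Mp * e ρ) := by
          rw [Finset.sum_mul]
          refine Finset.sum_congr rfl fun k hk => ?_
          have hkρ : k % (N : ℤ) = ρ := (Finset.mem_filter.mp hk).2
          obtain ⟨-, -, h3⟩ := hA_mod 0 k
          rw [h3, hkρ]; ring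
      _ ≤ σξ * (Mp * e ρ) := by
          refine mul_le_mul_of_nonneg_right ?_ (mul_nonneg hMp0 (he0 ρ))
          rw [hfib ρ hρ]
          have := hσ ρ
          simpa only [hξ] using this
      _ = σξ * Mp * e ρ := by ring
  -- Step 4: the residue sets as fibres of `l ↦ l mod N`, `Σ_ρ e ρ = Σ_l ‖c_l‖²`, Parseval
  have hSk_eq : ∀ n ∈ Finset.range N, Sk (n : ℤ) = S.filter (fun l => l % (N : ℤ) = n) := by
    intro n hn
    simp only [hSk]
    refine Finset.filter_congr fun l _ => ?_
    rw [← Int.modEq_iff_dvd]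
    show l % (N : ℤ) = (n : ℤ) % (N : ℤ) ↔ l % (N : ℤ) = n
    rw [Int.emod_eq_of_lt (a := (n : ℤ)) (b := (N : ℤ)) (Int.natCast_nonneg n)
      (by exact_mod_cast Finset.mem_range.mp hn)]
  have hesum : ∑ ρ ∈ t, e ρ = ∑ l ∈ S, ‖c l‖ ^ 2 := by
    rw [ht, Finset.sum_image (fun a _ b _ h => by exact_mod_cast h)]
    have h := Finset.sum_fiberwise_of_maps_to (s := S) (t := Finset.range N) (g := fun l : ℤ => (l % (N : ℤ)).toNat)
      (fun l _ => by
        have h1 := Int.emod_nonneg l hNz.ne'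
        have h2 := Int.emod_lt_of_pos l hNz
        exact Finset.mem_range.mpr (by omega)) (fun l => ‖c l‖ ^ 2)
    rw [← h]
    refine Finset.sum_congr rfl fun n hn => ?_
    simp only [he]
    rw [hSk_eq n hn]
    refine Finset.sum_congr (Finset.filter_congr fun l _ => ?_) fun _ _ => rfl
    have h1 := Int.emod_nonneg l hNz.ne'
    constructor
    · intro h0; rw [h0]; simp
    · intro h0; have := congrArg (fun x : ℕ => (x : ℤ)) h0; rw [Int.toNat_of_nonneg h1] at this; exact this
  have hexp_mod : ∀ (l : ℤ) (n r : ℕ), l % (N : ℤ) = n →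
      Complex.exp (2 * π * I * l * r / N) = Complex.exp (2 * π * I * n * r / N) := by
    intro l n r hln
    have hNc : (N : ℂ) ≠ 0 := by exact_mod_cast hN.ne'
    have hl : l = N * (l / N) + n := by have h := Int.emod_add_mul_ediv l N; rw [hln] at h; linarith
    conv_lhs => rw [hl]
    rw [show (2 * π * I * (((N : ℤ) * (l / N) + n : ℤ) : ℂ) * r / N : ℂ) =
        2 * π * I * n * r / N + ((l / N) * r : ℤ) * (2 * π * I) by push_cast; field_simp; ring,
      Complex.exp_add, Complex.exp_int_mul_two_pi_mul_I, mul_one]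
  have hParseval : ∀ (d : ℤ → ℂ) (w : ℤ → ℂ) (y₀ : ℝ), (∀ l : ℤ, w l = Complex.exp (2 * π * I * l * y₀)) →
      ∑ ρ ∈ t, ‖∑ l ∈ Sk ρ, d l * w l‖ ^ 2 =
        1 / N * ∑ r ∈ Finset.range N, ‖∑ l ∈ S, d l * Complex.exp (2 * π * I * l * ((r : ℝ) / N + y₀))‖ ^ 2 := by
    intro d w y₀ hw
    rw [ht, Finset.sum_image (fun a _ b _ h => by exact_mod_cast h)]
    have hP := dft_parseval_range hN (fun n => ∑ l ∈ Sk (n : ℤ), d l * w l)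
    have hT : ∀ r ∈ Finset.range N, ∑ n ∈ Finset.range N, Complex.exp (2 * π * I * n * r / N) *
        (∑ l ∈ Sk (n : ℤ), d l * w l) = ∑ l ∈ S, d l * Complex.exp (2 * π * I * l * ((r : ℝ) / N + y₀)) := by
      intro r _
      have h := Finset.sum_fiberwise_of_maps_to (s := S) (t := Finset.range N) (g := fun l : ℤ => (l % (N : ℤ)).toNat)
        (fun l _ => by
          have h1 := Int.emod_nonneg l hNz.ne'
          have h2 := Int.emod_lt_of_pos l hNz
          exact Finset.mem_range.mpr (by omega)) (fun l => d l * Complex.exp (2 * π * I * l * ((r : ℝ) / N + y₀)))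
      rw [← h]
      refine Finset.sum_congr rfl fun n hn => ?_
      rw [hSk_eq n hn, Finset.mul_sum]
      have hfil : S.filter (fun l => (l % (N : ℤ)).toNat = n) = S.filter (fun l => l % (N : ℤ) = n) := by
        refine Finset.filter_congr fun l _ => ?_
        have h1 := Int.emod_nonneg l hNz.ne'
        constructor
        · intro h0; have := congrArg (fun x : ℕ => (x : ℤ)) h0; rw [Int.toNat_of_nonneg h1] at this; exact this
        · intro h0; rw [h0]; simp
      rw [hfil]
      refine Finset.sum_congr rfl fun l hl => ?_
      have hln := (Finset.mem_filter.mp hl).2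
      rw [hw l, ← hexp_mod l n r hln, mul_left_comm, ← Complex.exp_add]
      congr 2
      push_cast
      ring
    have hcongr : ∑ r ∈ Finset.range N, ‖∑ n ∈ Finset.range N, Complex.exp (2 * π * I * n * r / N) *
        (∑ l ∈ Sk (n : ℤ), d l * w l)‖ ^ 2 =
        ∑ r ∈ Finset.range N, ‖∑ l ∈ S, d l * Complex.exp (2 * π * I * l * ((r : ℝ) / N + y₀))‖ ^ 2 :=
      Finset.sum_congr rfl fun r hr => by rw [hT r hr]
    rw [hcongr] at hP
    have hNr' : (N : ℝ) ≠ 0 := hNr.ne'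
    field_simp
    linarith [hP]
  have hPA : ∀ i, ∑ ρ ∈ t, ‖A i ρ‖ ^ 2 = 1 / N * ∑ r ∈ Finset.range N,
      ‖∑ l ∈ S, c l * (l : ℂ) ^ i * Complex.exp (2 * π * I * l * ((4 * (r : ℝ) - 1) / (4 * N)))‖ ^ 2 := by
    intro i
    have h := hParseval (fun l => c l * (l : ℂ) ^ i) ω' (-1 / (4 * N))
      (fun l => by simp only [hω']; congr 1; push_cast; ring)
    simp only [hA]
    rw [h]
    congr 1
    refine Finset.sum_congr rfl fun r _ => ?_
    congr 2
    refine Finset.sum_congr rfl fun l _ => ?_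
    congr 2
    push_cast
    ring
  have hPA' : ∀ i, ∑ ρ ∈ t, ‖A' i ρ‖ ^ 2 = 1 / N * ∑ r ∈ Finset.range N,
      ‖∑ l ∈ S, c l * (l : ℂ) ^ i * Complex.exp (2 * π * I * l * ((4 * (r : ℝ) + 1) / (4 * N)))‖ ^ 2 := by
    intro i
    have h := hParseval (fun l => c l * (l : ℂ) ^ i) ω (1 / (4 * N))
      (fun l => by simp only [hω]; congr 1; push_cast; ring)
    simp only [hA']
    rw [h]
    congr 1
    refine Finset.sum_congr rfl fun r _ => ?_
    congr 2
    refine Finset.sum_congr rfl fun l _ => ?_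
    congr 2
    push_cast
    ring
  -- Step 5: assemble
  set TrM : ℕ → ℝ := fun i => ∑ r ∈ Finset.range N,
      ‖∑ l ∈ S, c l * (l : ℂ) ^ i * Complex.exp (2 * π * I * l * ((4 * (r : ℝ) - 1) / (4 * N)))‖ ^ 2 with hTrM
  set TrP : ℕ → ℝ := fun i => ∑ r ∈ Finset.range N,
      ‖∑ l ∈ S, c l * (l : ℂ) ^ i * Complex.exp (2 * π * I * l * ((4 * (r : ℝ) + 1) / (4 * N)))‖ ^ 2 with hTrP
  have hmain : ∑ k ∈ W, 2 * ΦΛ k * ∑ i ∈ Finset.range p, Φa i k / Λ ^ i * (‖A i k‖ ^ 2 + ‖A' i k‖ ^ 2) ≤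
      2 / N * ∑ i ∈ Finset.range p, τ i / Λ ^ (2 * i) * (TrM i + TrP i) := by
    calc ∑ k ∈ W, 2 * ΦΛ k * ∑ i ∈ Finset.range p, Φa i k / Λ ^ i * (‖A i k‖ ^ 2 + ‖A' i k‖ ^ 2)
        = ∑ k ∈ W, ∑ i ∈ Finset.range p, 2 * (ΦΛ k * (Φa i k / Λ ^ i * (‖A i k‖ ^ 2 + ‖A' i k‖ ^ 2))) := by
          refine Finset.sum_congr rfl fun k _ => ?_
          rw [Finset.mul_sum]
          exact Finset.sum_congr rfl fun i _ => by ring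
      _ = ∑ i ∈ Finset.range p, ∑ k ∈ W, 2 * (ΦΛ k * (Φa i k / Λ ^ i * (‖A i k‖ ^ 2 + ‖A' i k‖ ^ 2))) :=
          Finset.sum_comm
      _ = 2 * ∑ i ∈ Finset.range p, ∑ k ∈ W, ΦΛ k * (Φa i k / Λ ^ i * (‖A i k‖ ^ 2 + ‖A' i k‖ ^ 2)) := by
          rw [Finset.mul_sum]
          exact Finset.sum_congr rfl fun i _ => by rw [Finset.mul_sum]
      _ ≤ 2 * ∑ i ∈ Finset.range p, τ i / Λ ^ (2 * i) * ∑ ρ ∈ t, (‖A i ρ‖ ^ 2 + ‖A' i ρ‖ ^ 2) :=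
          mul_le_mul_of_nonneg_left (Finset.sum_le_sum hmain_i) (by norm_num)
      _ = 2 / N * ∑ i ∈ Finset.range p, τ i / Λ ^ (2 * i) * (TrM i + TrP i) := by
          rw [Finset.mul_sum, Finset.mul_sum]
          refine Finset.sum_congr rfl fun i _ => ?_
          rw [Finset.sum_add_distrib, hPA i, hPA' i]
          ring
  calc ∑ k ∈ W, ‖∑ l ∈ S, c l * fourierCoeff g₀ (k - l)‖ ^ 2
      ≤ ∑ k ∈ W, ((N : ℝ) / (2 * π)) ^ 2 * ((1 + ε) * (2 * ΦΛ k * ∑ i ∈ Finset.range p, Φa i k / Λ ^ i *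
          (‖A i k‖ ^ 2 + ‖A' i k‖ ^ 2)) + (1 + ε⁻¹) * (4 * ξ k ^ 2 * Mp * e k)) := Finset.sum_le_sum hsq
    _ = ((N : ℝ) / (2 * π)) ^ 2 * (1 + ε) * (∑ k ∈ W, 2 * ΦΛ k * ∑ i ∈ Finset.range p, Φa i k / Λ ^ i *
          (‖A i k‖ ^ 2 + ‖A' i k‖ ^ 2)) + ((N : ℝ) / (2 * π)) ^ 2 * (1 + ε⁻¹) * 4 * (∑ k ∈ W, ξ k ^ 2 * Mp * e k) := by
        symm
        rw [Finset.mul_sum, Finset.mul_sum, ← Finset.sum_add_distrib]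
        exact Finset.sum_congr rfl fun k _ => by ring
    _ ≤ ((N : ℝ) / (2 * π)) ^ 2 * (1 + ε) * (2 / N * ∑ i ∈ Finset.range p, τ i / Λ ^ (2 * i) * (TrM i + TrP i)) +
          ((N : ℝ) / (2 * π)) ^ 2 * (1 + ε⁻¹) * 4 * (σξ * Mp * ∑ ρ ∈ t, e ρ) := by
        have h1 : 0 ≤ ((N : ℝ) / (2 * π)) ^ 2 * (1 + ε) := by positivity
        have h2 : 0 ≤ ((N : ℝ) / (2 * π)) ^ 2 * (1 + ε⁻¹) * 4 := by positivity
        exact add_le_add (mul_le_mul_of_nonneg_left hmain h1) (mul_le_mul_of_nonneg_left hrem h2)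
    _ = _ := by
        rw [hesum]
        simp only [hTrM, hTrP]
        field_simp
        ring

end Summit.AnomalousDissipation.AnomalousDissipation.Theorems.SawtoothPulseCascade.K1Window
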